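import Literature.NumberTheory.EllipticCurves.RankinSelbergEulerProductHeckeInducedProofs
import Literature.NumberTheory.GaloisRepresentations.HeckeCharacterCompRelNormValueProofs
import HarnessLib

/-!
# `L_L(η · χ∘N_{L/K}, s) = L(f/K, χ, s)` from the local polynomial identities ALONE (all places)

Topic `NumberTheory/EllipticCurves` (namespace `Literature.NumberTheory.EllipticCurves`). PROOFS ONLY (no
definition, no named fact, no `sorry`). Sequel of `RankinSelbergEulerProductHeckeInducedProofs`: there the local
step `localFactor_eq_finprod_of_polynomial_identity` carried the extra hypothesis "`η` is ramified above the primes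
of `K` ramified in `L`", only because the value `(χ∘N)(ϖ_w) = χ(ϖ_v)^{f(w|v)}` was available in the tree at
unramified `v` alone. With `HeckeCharacter.compRelNorm_valueAtUniformizer_eq_pow` (all `w ∣ v`,
`HeckeCharacterCompRelNormValueProofs`) that hypothesis disappears:

* `localFactor_eq_finprod_of_polynomial_identity'` — at every prime `v` of `K`, the polynomial identity
  `1 − t_v X + e_v^{k_v} X² = ∏_{w ∣ v} (1 − η̃(w) X^{f(w|v)})` alone gives
  `rankinSelbergLocalFactorInvHecke f χ v s = ∏_{w ∣ v} (1 − (η·χ∘N)~(w) N(w)^{−s})` (`χ` unramified at `v`).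
* `heckeLFunction_mul_compRelNorm_eq_rankinSelbergEulerProductHecke'`, `heckeLFunction_mul_norm_mul_compRelNorm_eq'`,
  **`hEP_of_polynomial_identities'`** — the global identities and the Euler-product hypothesis `hEP` of
  `hLval_of_hasKatzType_of_heckeLFunction_eq` (`c_L = c_L′ = 1`) from the polynomial identities only.

Route `BiquadraticEisensteinDescent` (`Summits/BirchSwinnertonDyer`, crux `EisensteinHeartFlatCMInertBadKPrime`, (L)).
References: [SilvermanATAEC1994] Ch. II Thm. 10.5 (b), Ex. 2.32; [NeukirchANT1999] Ch. VII (10.4)(iv);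
[CasselsFrohlichANT1967] Ch. VII §1.2.
-/

noncomputable section

open scoped NumberField
open NumberField IsDedekindDomain Ideal Complex CongruenceSubgroup
open Literature.NumberTheory.GaloisRepresentations
open Literature.NumberTheory.EllipticCurves.ModularForms

namespace Literature.NumberTheory.EllipticCurves

variable {K : Type} [Field K] [NumberField K] {L : Type} [Field L] [NumberField L] [Algebra K L] [IsGalois K L]
  {N : ℕ}

/-- `(χψ)(ϖ_w) = χ(ϖ_w) ψ(ϖ_w)`. [cite: TateThesis1967, §2.5] -/
private theorem valueAtUniformizer_mul'' (χ ψ : HeckeCharacter L) (w : HeightOneSpectrum (𝓞 L)) :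
    (χ * ψ).valueAtUniformizer w = χ.valueAtUniformizer w * ψ.valueAtUniformizer w := by
  simp only [HeckeCharacter.valueAtUniformizer, HeckeCharacter.localComponent_apply, HeckeCharacter.mul_apply,
    Units.val_mul]

/-- **The inverse Rankin–Selberg local factor at `v` as the product of the inverse Hecke local factors over `w ∣ v`,
from the polynomial identity alone** (`μ = η · χ∘N_{L/K}`, `χ` unramified at `v`; any ramification of `v` in `L`):
substitute `X = χ(ϖ_v) N(v)^{−s}` in `1 − t_v X + e_v^{k_v} X² = ∏_{w ∣ v} (1 − η̃(w) X^{f(w|v)})` and use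
`(χ∘N)(ϖ_w) = χ(ϖ_v)^{f(w|v)}` (all `w`), `N(w) = N(v)^{f(w|v)}`.
[cite: SilvermanATAEC1994, Ch. II Ex. 2.32 (a) (p. 179)] [cite: NeukirchANT1999, Ch. VII (10.4)(iv)] -/
theorem localFactor_eq_finprod_of_polynomial_identity' (f : CuspForm (Gamma0 N) 2) (η : HeckeCharacter L)
    {χ : HeckeCharacter K} (v : HeightOneSpectrum (𝓞 K)) (hu : χ.IsUnramifiedAt v)
    (hpoly : ∀ X : ℂ,
      1 - frobTracePow (cuspCoeff f (Ideal.absNorm v.asIdeal).minFac)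
            (if (Ideal.absNorm v.asIdeal).minFac ∣ N then 0 else ((Ideal.absNorm v.asIdeal).minFac : ℂ))
            ((Ideal.absNorm v.asIdeal).factorization (Ideal.absNorm v.asIdeal).minFac) * X +
        (if (Ideal.absNorm v.asIdeal).minFac ∣ N then 0 else ((Ideal.absNorm v.asIdeal).minFac : ℂ)) ^
            ((Ideal.absNorm v.asIdeal).factorization (Ideal.absNorm v.asIdeal).minFac) * X ^ 2 =
      ∏ᶠ w ∈ {w : HeightOneSpectrum (𝓞 L) | w.under (𝓞 K) = v},
        (1 - heckeValueExtZero η w * X ^ w.asIdeal.inertiaDeg (𝓞 K))) (s : ℂ) :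
    rankinSelbergLocalFactorInvHecke f χ v s =
      ∏ᶠ w ∈ {w : HeightOneSpectrum (𝓞 L) | w.under (𝓞 K) = v},
        (1 - heckeValueExtZero (η * χ.compRelNorm L) w * ((Ideal.absNorm w.asIdeal : ℕ) : ℂ) ^ (-s)) := by
  set q : ℕ := Ideal.absNorm v.asIdeal with hq
  set X : ℂ := heckeValueExtZero χ v * ((q : ℕ) : ℂ) ^ (-s) with hX
  have hRS : rankinSelbergLocalFactorInvHecke f χ v s =
      1 - frobTracePow (cuspCoeff f q.minFac) (if q.minFac ∣ N then 0 else (q.minFac : ℂ))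
            (q.factorization q.minFac) * X +
        (if q.minFac ∣ N then 0 else (q.minFac : ℂ)) ^ (q.factorization q.minFac) * X ^ 2 := by
    rw [rankinSelbergLocalFactorInvHecke_eq_one_sub, hX, show (-2 * s : ℂ) = (2 : ℕ) * (-s) by push_cast; ring,
      Complex.cpow_nat_mul]
    ring
  rw [hRS, hpoly X]
  refine finprod_mem_congr rfl fun w hw ↦ ?_
  have hw' : w.under (𝓞 K) = v := hw
  congr 1
  have hχL : (χ.compRelNorm L).IsUnramifiedAt w := χ.compRelNorm_isUnramifiedAt (by rw [hw']; exact hu)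
  by_cases hη : η.IsUnramifiedAt w
  · have hμ : (η * χ.compRelNorm L).IsUnramifiedAt w := hη.mul' hχL
    rw [heckeValueExtZero_of_isUnramifiedAt hη, heckeValueExtZero_of_isUnramifiedAt hμ, valueAtUniformizer_mul'',
      HeckeCharacter.compRelNorm_valueAtUniformizer_eq_pow χ hw' hu, absNorm_eq_pow_inertiaDeg_under hw', hX,
      heckeValueExtZero_of_isUnramifiedAt hu, mul_pow, Nat.cast_pow, ← hq,
      ← Complex.cpow_nat_mul, ← Complex.natCast_cpow_natCast_mul]
    ring
  · have hμ : ¬ (η * χ.compRelNorm L).IsUnramifiedAt w :=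
      fun h ↦ hη ((KatzCM.isUnramifiedAt_mul_iff_of_range hχL).mp h)
    rw [heckeValueExtZero_of_not_isUnramifiedAt hη, heckeValueExtZero_of_not_isUnramifiedAt hμ, zero_mul,
      zero_mul]

/-- **`L_L(η · χ∘N_{L/K}, s) = L(f/K, χ, s)` as Euler products for `re s > 1 − σ`**, from the polynomial identities
at every prime of `K` alone (`σ` the exponent of `η`; `χ` unitary, unramified everywhere).
[cite: SilvermanATAEC1994, Ch. II Thm. 10.5 (b) and Ex. 2.32 (p. 171–179)] [cite: NeukirchANT1999, Ch. VII (10.4)(iv)] -/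
theorem heckeLFunction_mul_compRelNorm_eq_rankinSelbergEulerProductHecke' {η : HeckeCharacter L} {σ : ℝ}
    (hη : ∀ x : ideleGroup L, ‖((η x : ℂˣ) : ℂ)‖ = ideleNorm x ^ σ) {χ : HeckeCharacter K} (hχu : χ.IsUnitary)
    (hu : ∀ v : HeightOneSpectrum (𝓞 K), χ.IsUnramifiedAt v) (f : CuspForm (Gamma0 N) 2)
    (hpoly : ∀ (v : HeightOneSpectrum (𝓞 K)) (X : ℂ),
      1 - frobTracePow (cuspCoeff f (Ideal.absNorm v.asIdeal).minFac)
            (if (Ideal.absNorm v.asIdeal).minFac ∣ N then 0 else ((Ideal.absNorm v.asIdeal).minFac : ℂ))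
            ((Ideal.absNorm v.asIdeal).factorization (Ideal.absNorm v.asIdeal).minFac) * X +
        (if (Ideal.absNorm v.asIdeal).minFac ∣ N then 0 else ((Ideal.absNorm v.asIdeal).minFac : ℂ)) ^
            ((Ideal.absNorm v.asIdeal).factorization (Ideal.absNorm v.asIdeal).minFac) * X ^ 2 =
      ∏ᶠ w ∈ {w : HeightOneSpectrum (𝓞 L) | w.under (𝓞 K) = v},
        (1 - heckeValueExtZero η w * X ^ w.asIdeal.inertiaDeg (𝓞 K)))
    {s : ℂ} (hs : 1 < σ + s.re) :
    heckeLFunction (η * χ.compRelNorm L) s = rankinSelbergEulerProductHecke f χ s :=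
  heckeLFunction_eq_rankinSelbergEulerProductHecke_of_local (norm_mul_compRelNorm_apply hη hχu) hs f χ
    fun v ↦ localFactor_eq_finprod_of_polynomial_identity' f η v (hu v) (hpoly v) s

/-- **The shift**: `L_L(η · ν · χ∘N, s − 1) = L(f/K, χ, s)` on `re s > 3/2` for `ν(x) = ‖x‖`, `η` of exponent `−1/2`,
from the polynomial identities alone. [cite: SilvermanATAEC1994, Ch. II Thm. 10.5 (b) (p. 171–172)]
[cite: TateThesis1967, §4.4] -/
theorem heckeLFunction_mul_norm_mul_compRelNorm_eq' {η : HeckeCharacter L}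
    (hη : ∀ x : ideleGroup L, ‖((η x : ℂˣ) : ℂ)‖ = ideleNorm x ^ (-(1 / 2 : ℝ))) {ν : HeckeCharacter L}
    (hν : ∀ x : ideleGroup L, ((ν x : ℂˣ) : ℂ) = ((ideleNorm x : ℝ) : ℂ) ^ (1 : ℂ)) {χ : HeckeCharacter K}
    (hχu : χ.IsUnitary) (hu : ∀ v : HeightOneSpectrum (𝓞 K), χ.IsUnramifiedAt v) (f : CuspForm (Gamma0 N) 2)
    (hpoly : ∀ (v : HeightOneSpectrum (𝓞 K)) (X : ℂ),
      1 - frobTracePow (cuspCoeff f (Ideal.absNorm v.asIdeal).minFac)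
            (if (Ideal.absNorm v.asIdeal).minFac ∣ N then 0 else ((Ideal.absNorm v.asIdeal).minFac : ℂ))
            ((Ideal.absNorm v.asIdeal).factorization (Ideal.absNorm v.asIdeal).minFac) * X +
        (if (Ideal.absNorm v.asIdeal).minFac ∣ N then 0 else ((Ideal.absNorm v.asIdeal).minFac : ℂ)) ^
            ((Ideal.absNorm v.asIdeal).factorization (Ideal.absNorm v.asIdeal).minFac) * X ^ 2 =
      ∏ᶠ w ∈ {w : HeightOneSpectrum (𝓞 L) | w.under (𝓞 K) = v},
        (1 - heckeValueExtZero η w * X ^ w.asIdeal.inertiaDeg (𝓞 K)))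
    {s : ℂ} (hs : 3 / 2 < s.re) :
    heckeLFunction (η * ν * χ.compRelNorm L) (s - 1) = rankinSelbergEulerProductHecke f χ s := by
  rw [mul_right_comm, HeckeCharacter.heckeLFunction_mul_eq_of_forall_apply_eq_cpow _ hν, sub_add_cancel]
  exact heckeLFunction_mul_compRelNorm_eq_rankinSelbergEulerProductHecke' hη hχu hu f hpoly (by linarith)

/-- **The Euler-product hypothesis `hEP` of `hLval_of_hasKatzType_of_heckeLFunction_eq` (`c_L = c_L′ = 1`) for
`λ = η · ν` from the local polynomial identities alone** (`K` totally complex, so the characters of Hsieh's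
range are unitary). [cite: SilvermanATAEC1994, Ch. II Thm. 10.5 (b) and Ex. 2.32 (p. 171–179)]
[cite: NeukirchANT1999, Ch. VII (10.4)(iv)] -/
theorem hEP_of_polynomial_identities' [IsTotallyComplex K] {η : HeckeCharacter L}
    (hη : ∀ x : ideleGroup L, ‖((η x : ℂˣ) : ℂ)‖ = ideleNorm x ^ (-(1 / 2 : ℝ))) {ν : HeckeCharacter L}
    (hν : ∀ x : ideleGroup L, ((ν x : ℂˣ) : ℂ) = ((ideleNorm x : ℝ) : ℂ) ^ (1 : ℂ)) (f : CuspForm (Gamma0 N) 2)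
    (hpoly : ∀ (v : HeightOneSpectrum (𝓞 K)) (X : ℂ),
      1 - frobTracePow (cuspCoeff f (Ideal.absNorm v.asIdeal).minFac)
            (if (Ideal.absNorm v.asIdeal).minFac ∣ N then 0 else ((Ideal.absNorm v.asIdeal).minFac : ℂ))
            ((Ideal.absNorm v.asIdeal).factorization (Ideal.absNorm v.asIdeal).minFac) * X +
        (if (Ideal.absNorm v.asIdeal).minFac ∣ N then 0 else ((Ideal.absNorm v.asIdeal).minFac : ℂ)) ^
            ((Ideal.absNorm v.asIdeal).factorization (Ideal.absNorm v.asIdeal).minFac) * X ^ 2 =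
      ∏ᶠ w ∈ {w : HeightOneSpectrum (𝓞 L) | w.under (𝓞 K) = v},
        (1 - heckeValueExtZero η w * X ^ w.asIdeal.inertiaDeg (𝓞 K))) :
    ∀ (χ : HeckeCharacter K) (n : ℕ), 0 < n → (∀ v : HeightOneSpectrum (𝓞 K), χ.IsUnramifiedAt v) →
      χ.HasInfinityType (fun _ ↦ (n : ℤ)) (fun _ ↦ -(n : ℤ)) →
      ∀ s : ℂ, 3 / 2 < s.re →
        heckeLFunction (η * ν * χ.compRelNorm L) (s - 1) = 1 * 1 ^ n * rankinSelbergEulerProductHecke f χ s :=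
  fun _ _ _ hu hi s hs ↦ by
    rw [one_pow, one_mul, one_mul]
    exact heckeLFunction_mul_norm_mul_compRelNorm_eq' hη hν (isUnitary_of_hasInfinityType_self_neg hi) hu f
      hpoly hs

end Literature.NumberTheory.EllipticCurves

end
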